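import Summits.BirchSwinnertonDyer.Rank1Residual.X5.TwoAdicTargetsEisenstein
import Summits.BirchSwinnertonDyer.Rank1Residual.X1.MuLambdaAlgebra
import HarnessLib

/-!
# Route `TwoAdicConverse` (rung S3) — the `λ`-HALF of the `2`-adic main conjecture as CLOSED `Prop` leaves
# (importable by the route file; no Theses file imported)

Why this file exists (seat bsd-2adic-conv-1 GEN 2, 2026-08-26): `Theorems/TwoAdicConverseGoodOrdinaryTwistFamily.lean`
(p424885) proves that the crux `GoodOrdinaryRankZeroTwoConverse` (item stmt-BirchSwinnertonDyer-19218) follows from the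
PUBLISHED inputs (item 19167) and ONE inequality per curve — `λ(c·L₂(E)) ≤ λ(X(E/ℚ_∞))` at the cyclotomic data, for
some nonzero integral rational multiple of the `2`-adic `L`-function — WITHOUT the `μ`-inequality that the registered child
`OrdEisensteinHalfAtTwo` (item 19272 = Greenberg–Vatsal's pair `λ_an ≤ λ_alg ∧ μ_an ≤ μ_alg` up to slack, seat ord-3's
`ordEisensteinHalfAtTwo_iff_forall_lam_le_and_mu_le`) also carries (`goodOrdinaryRankZeroTwoConverse_of_forall_lam_le`,
hypothesis written inline there). So that a planner MAY re-split 19218 along the weaker child, the per-curve predicate and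
its ∀-closure over the class are stated here as `@[conjecture] def`s, in the exact inline shape of p424885 plus the guard
`IsOrdinaryAt W 2` of the cell's convention (`X5.O1.MainConjectureEisensteinDivisibilityAtTwo`: off the ordinary locus
`unitRoot W 2 = 0` is junk). NOTHING is asserted; no `sorry`; no Literature fact; not in print at `p = 2` (Skinner–Urban
2014 Thm. 3.6.9 / Greenberg–Vatsal 2000 give `λ_an ≤ λ_alg` only for odd `p`). Bridges (`… → crux`, `19272 → …`, the
twist-family transport concluding the per-curve predicate) are landed separately once this module is built.
-/

set_option linter.dupNamespace false
set_option autoImplicit false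

noncomputable section

open scoped MatrixGroups ModularForm
open CongruenceSubgroup WeierstrassCurve Literature.NumberTheory.EllipticCurves
  Literature.NumberTheory.EllipticCurves.ModularForms Literature.NumberTheory.EllipticCurves.Rank1Residual

namespace Summit.BirchSwinnertonDyer.BirchSwinnertonDyer.Theorems.TwoAdicTwistConverse

/-- **The `λ`-half of the `2`-adic cyclotomic main conjecture at ONE curve** (`E = W` globally minimal): IF `E` is good
ordinary at `2` (guard), then for the cyclotomic `ℤ₂`-extension with matching generator, every newform `f` of `E` at level
`N_E` and every dual datum `D` of `X(E/ℚ_∞)`, SOME nonzero integral rational multiple `L₀ ∈ Λ = ℤ₂⟦T⟧` of the `2`-adic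
`L`-function (`ι L₀ = c·L₂(f,α)`, `c ∈ ℚ`; `λ(L₀)` does not depend on the nonzero scalar, and such an `L₀` always exists by
`exists_integral_slack`) satisfies `λ(L₀) ≤ λ(X(E/ℚ_∞))` — Greenberg–Vatsal's `λ_an ≤ λ_alg`, the `λ`-component of the
Eisenstein (Skinner–Urban) inclusion `char_Λ X ⊆ (L₂)`. On the finite-`Sel` locus it is exactly what the rank-`0`
`2`-converse consumes (`analyticRank_eq_zero_of_selmerCorank_eq_zero_of_lam_le`, p424885). Printed only for odd `p`;
nothing asserted. STATEMENT SHAPE (plain `def`): a per-curve predicate can never be a ledger item, so it carries NO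
`@[conjecture]` tag (director-bsd 2026-08-26T10:13Z; K4 precedent `ByReductionTypeAtTwoOrdHalvesDefs.lean`) — the
conjecture-grade object is its `∀`-closure `OrdLambdaHalfAtTwo` below (item stmt-BirchSwinnertonDyer-19556 of route
TwoAdicConverse, written out there verbatim). [cite: GreenbergVatsal2000, p. 4 (after Thm. (1.2)) (p odd; shape only; nothing asserted)]
[cite: SkinnerUrban2014, Thm. 3.6.9 (p odd; shape only; nothing asserted)] -/
def LambdaHalfAtTwo (W : WeierstrassCurve ℚ) [W.IsElliptic] [W.IsGloballyMinimal] : Prop :=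
  ∀ (κ : ZpExtension ℚ 2) (γ : Field.absoluteGaloisGroup ℚ),
    κ.IsCyclotomic → κ.IsTopGenerator γ → IsCyclotomicVariable 2 γ → IsOrdinaryAt W 2 →
    ∀ [NeZero (W.conductorNorm ℤ)] (f : CuspForm (Gamma0 (W.conductorNorm ℤ)) 2), IsNewformOf W f →
    ∀ (D : W.SelmerDualData κ γ), ∃ (c : ℚ) (L₀ : IwasawaAlgebra 2), L₀ ≠ 0 ∧
      iwasawaToPowerSeries 2 L₀ = PowerSeries.C (c : ℚ_[2]) * padicLFunction f (unitRoot W 2 : ℚ_[2]) ∧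
      Summit.BirchSwinnertonDyer.Rank1Residual.X1.MuLambda.lam L₀ ≤ D.lambda

/-- **[proposed crux child] The `λ`-HALF of the `2`-adic main conjecture on the class «non-CM, good ordinary at `2`»**:
`LambdaHalfAtTwo W` for every such globally minimal `W`. A sufficient child of item 19218 STRICTLY WEAKER than the
registered child `OrdEisensteinHalfAtTwo` (item 19272), which adds `μ_an ≤ μ_alg` (+ slack): PUBLISHED inputs (item
19167) ∧ this ⟹ `GoodOrdinaryRankZeroTwoConverse` (bridge landed separately; inline form already in p424885 as
`goodOrdinaryRankZeroTwoConverse_of_forall_lam_le`). Nothing in print at `p = 2`; nothing asserted. Since route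
TwoAdicConverse rev 8–11 (2026-08-26) this IS the crux item stmt-BirchSwinnertonDyer-19556 (the route decl spells this
body out; `Iff.rfl`). [cite: GreenbergVatsal2000, p. 4 (after Thm. (1.2)) (p odd; shape only; nothing asserted)] -/
@[conjecture] def OrdLambdaHalfAtTwo : Prop :=
  ∀ (W : WeierstrassCurve ℚ) [W.IsElliptic] [W.IsGloballyMinimal], ¬ W.HasCM → GoodOrd W 2 → LambdaHalfAtTwo W

end Summit.BirchSwinnertonDyer.BirchSwinnertonDyer.Theorems.TwoAdicTwistConverse

end
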